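import Mathlib
import HarnessLib

/-!
# Route `VirialFluxGap` (YangMills): two analysis tools for the Tauberian mean bound — CHEBYSHEV's association inequality and GAMMA moments

Second helper file toward stub `stub_tauberMeanUpper` of LINE «tauber-mean» (planner ym-idea-4 g14) on the deciding crux
`VirialFluxGap.PeriodicSoftness` (stmt-QuantumFields-24141).  Mathlib only.

* §1 `integral_mul_mul_measureReal_le` — CHEBYSHEV'S ASSOCIATION (rearrangement) INEQUALITY for a finite measure `ν` on `ℝ` carried by a
  set `S`: if `f` is monotone on `S` and `h` antitone on `S` (both integrable, `f·h` integrable) then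
  `(∫ f·h dν)·ν(ℝ) ≤ (∫ f dν)·(∫ h dν)` — proof: `∬ (f x − f y)(h x − h y) d(ν⊗ν) ≤ 0` pointwise, expanded by Fubini.  (This is the
  «the log factor only LOWERS the mean» step of the «tauber-mean» card: the slowly varying factor `ℓ(t)·𝟙_{t ≤ t₀}` is decreasing.)
* §2 Gamma moments: `∫_{s>0} s^a e^{−βs} ds = Γ(a+1)/β^{a+1}` (`integral_rpow_mul_exp_neg_mul_Ioi'`) and the log-convexity consequence
  `Γ(x + θ) ≤ Γ(x)·x^θ` for `x > 0`, `0 ≤ θ ≤ 1` (`Real.Gamma_mul_add_mul_le_rpow_Gamma_mul_rpow_Gamma`, Bohr–Mollerup), which bounds the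
  fractional moments `E[s^θ]`, `E[s^{1+θ}]` of a `Gamma(ρ+1, β)` law by `((ρ+1)/β)^θ`, `(ρ+1)(ρ+2)^θ/β^{1+θ}`.

HONEST FRAMING: generic real analysis; no stub / crux / rung / summit is closed by this file; the Yang–Mills mass gap is NOT proved.  THEOREMS ONLY
(0 `def`, 0 `sorry`), standard axioms.  References: [cite: Griffiths1964]; [cite: TomboulisYaffe1985].
-/

set_option autoImplicit false

noncomputable section

open MeasureTheory Set Filter Real
open scoped Topology

namespace Summit.QuantumFields.YangMills.Theorems.VirialFluxGap.ChebyshevGamma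

/-! ## §1 Chebyshev's association inequality -/

/-- ★★ **Chebyshev's association inequality** (integral form): for a finite measure `ν` on `ℝ` carried by `S`, `f` monotone on `S`, `h` antitone
on `S`, all of `f`, `h`, `f·h` integrable: `(∫ f h dν) · ν(univ) ≤ (∫ f dν)(∫ h dν)`. [folklore] -/
theorem integral_mul_mul_measureReal_le (ν : Measure ℝ) [IsFiniteMeasure ν] {S : Set ℝ} {f h : ℝ → ℝ}
    (hS : ∀ᵐ x ∂ν, x ∈ S) (hf : MonotoneOn f S) (hh : AntitoneOn h S)
    (hfi : Integrable f ν) (hhi : Integrable h ν) (hfh : Integrable (fun x => f x * h x) ν) :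
    (∫ x, f x * h x ∂ν) * ν.real univ ≤ (∫ x, f x ∂ν) * (∫ x, h x ∂ν) := by
  -- the symmetrised integrand is pointwise `≤ 0` on `S × S`
  have hpt : ∀ x ∈ S, ∀ y ∈ S, (f x - f y) * (h x - h y) ≤ 0 := by
    intro x hx y hy
    rcases le_total x y with hxy | hxy
    · exact mul_nonpos_of_nonpos_of_nonneg (sub_nonpos.mpr (hf hx hy hxy)) (sub_nonneg.mpr (hh hx hy hxy))
    · exact mul_nonpos_of_nonneg_of_nonpos (sub_nonneg.mpr (hf hy hx hxy)) (sub_nonpos.mpr (hh hy hx hxy))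
  have hae : ∀ᵐ p ∂(ν.prod ν), (f p.1 - f p.2) * (h p.1 - h p.2) ≤ 0 := by
    have h1 : ∀ᵐ p ∂(ν.prod ν), p.1 ∈ S :=
      (Measure.quasiMeasurePreserving_fst (μ := ν) (ν := ν)).ae hS
    have h2 : ∀ᵐ p ∂(ν.prod ν), p.2 ∈ S :=
      (Measure.quasiMeasurePreserving_snd (μ := ν) (ν := ν)).ae hS
    filter_upwards [h1, h2] with p hp1 hp2 using hpt p.1 hp1 p.2 hp2
  have hI : ∫ p, (f p.1 - f p.2) * (h p.1 - h p.2) ∂(ν.prod ν) ≤ 0 :=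
    integral_nonpos_of_ae hae
  -- the four product-integrable pieces
  have i1 : Integrable (fun p : ℝ × ℝ => (f p.1 * h p.1) * (1 : ℝ)) (ν.prod ν) := hfh.mul_prod (integrable_const 1)
  have i2 : Integrable (fun p : ℝ × ℝ => (1 : ℝ) * (f p.2 * h p.2)) (ν.prod ν) := (integrable_const 1).mul_prod hfh
  have i3 : Integrable (fun p : ℝ × ℝ => f p.1 * h p.2) (ν.prod ν) := hfi.mul_prod hhi
  have i4 : Integrable (fun p : ℝ × ℝ => h p.1 * f p.2) (ν.prod ν) := hhi.mul_prod hfi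
  have hexp : ∀ p : ℝ × ℝ, (f p.1 - f p.2) * (h p.1 - h p.2) =
      ((f p.1 * h p.1) * (1 : ℝ) + (1 : ℝ) * (f p.2 * h p.2)) - (f p.1 * h p.2 + h p.1 * f p.2) := fun p => by ring
  simp_rw [hexp] at hI
  have i12 : Integrable (fun p : ℝ × ℝ => (f p.1 * h p.1) * (1 : ℝ) + (1 : ℝ) * (f p.2 * h p.2)) (ν.prod ν) := i1.add i2
  have i34 : Integrable (fun p : ℝ × ℝ => f p.1 * h p.2 + h p.1 * f p.2) (ν.prod ν) := i3.add i4
  rw [integral_sub i12 i34, integral_add i1 i2, integral_add i3 i4,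
    integral_prod_mul (μ := ν) (ν := ν) (fun x => f x * h x) (fun _ => (1 : ℝ)),
    integral_prod_mul (μ := ν) (ν := ν) (fun _ => (1 : ℝ)) (fun y => f y * h y),
    integral_prod_mul (μ := ν) (ν := ν) f h, integral_prod_mul (μ := ν) (ν := ν) h f] at hI
  simp only [integral_const, smul_eq_mul, mul_one] at hI
  nlinarith [hI, mul_comm (∫ x, f x ∂ν) (∫ x, h x ∂ν)]

/-! ## §2 Gamma moments -/

/-- `∫_{s>0} s^a e^{−βs} ds = Γ(a+1)/β^{a+1}` for `a > −1`, `β > 0`. [folklore] -/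
theorem integral_rpow_mul_exp_neg_mul_Ioi' {a β : ℝ} (ha : -1 < a) (hβ : 0 < β) :
    ∫ s in Ioi (0 : ℝ), s ^ a * Real.exp (-(β * s)) = Real.Gamma (a + 1) / β ^ (a + 1) := by
  have h := Real.integral_rpow_mul_exp_neg_mul_Ioi (a := a + 1) (r := β) (by linarith) hβ
  simp only [add_sub_cancel_right] at h
  rw [h, one_div, Real.inv_rpow hβ.le, div_eq_inv_mul]

/-- `s ↦ s^a e^{−βs}` is integrable on `(0,∞)` for `a > −1`, `β > 0`. [folklore] -/
theorem integrableOn_rpow_mul_exp_neg_mul {a β : ℝ} (ha : -1 < a) (hβ : 0 < β) :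
    IntegrableOn (fun s : ℝ => s ^ a * Real.exp (-(β * s))) (Ioi 0) := by
  have h := integrableOn_rpow_mul_exp_neg_mul_rpow (s := a) (p := 1) (b := β) ha le_rfl hβ
  refine h.congr_fun (fun s _ => ?_) measurableSet_Ioi
  simp only [Real.rpow_one, neg_mul]

/-- ★ **Log-convexity of `Γ` in moment form**: `Γ(x + θ) ≤ Γ(x) · x^θ` for `x > 0`, `0 ≤ θ ≤ 1` (Bohr–Mollerup). [folklore] -/
theorem Gamma_add_le_Gamma_mul_rpow {x θ : ℝ} (hx : 0 < x) (hθ0 : 0 ≤ θ) (hθ1 : θ ≤ 1) :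
    Real.Gamma (x + θ) ≤ Real.Gamma x * x ^ θ := by
  have hΓ : 0 < Real.Gamma x := Real.Gamma_pos_of_pos hx
  rcases hθ0.eq_or_lt with h0 | h0
  · rw [← h0, add_zero, Real.rpow_zero, mul_one]
  rcases hθ1.lt_or_eq with h1 | h1
  · -- `0 < θ < 1`: `Γ((1−θ)x + θ(x+1)) ≤ Γ(x)^{1−θ} Γ(x+1)^θ = Γ(x) x^θ`
    have h := Real.Gamma_mul_add_mul_le_rpow_Gamma_mul_rpow_Gamma hx (by linarith : 0 < x + 1)
      (by linarith : 0 < 1 - θ) h0 (by ring)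
    have hx1 : (1 - θ) * x + θ * (x + 1) = x + θ := by ring
    rw [hx1, Real.Gamma_add_one hx.ne'] at h
    calc Real.Gamma (x + θ) ≤ Real.Gamma x ^ (1 - θ) * (x * Real.Gamma x) ^ θ := h
      _ = Real.Gamma x * x ^ θ := by
          rw [Real.mul_rpow hx.le hΓ.le, ← mul_assoc, mul_comm (Real.Gamma x ^ (1 - θ)), mul_assoc,
            ← Real.rpow_add hΓ, show 1 - θ + θ = 1 by ring, Real.rpow_one, mul_comm]
  · rw [h1, Real.Gamma_add_one hx.ne', Real.rpow_one, mul_comm]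

/-- `Γ(x + 1 + θ) ≤ Γ(x)·x·(x+1)^θ ≤ Γ(x)·(x+1)^{1+θ}` for `x > 0`, `0 ≤ θ ≤ 1`. [folklore] -/
theorem Gamma_add_one_add_le {x θ : ℝ} (hx : 0 < x) (hθ0 : 0 ≤ θ) (hθ1 : θ ≤ 1) :
    Real.Gamma (x + 1 + θ) ≤ Real.Gamma x * (x + 1) ^ (1 + θ) := by
  have hΓ : 0 < Real.Gamma x := Real.Gamma_pos_of_pos hx
  have h := Gamma_add_le_Gamma_mul_rpow (x := x + 1) (by linarith) hθ0 hθ1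
  rw [Real.Gamma_add_one hx.ne'] at h
  calc Real.Gamma (x + 1 + θ) ≤ x * Real.Gamma x * (x + 1) ^ θ := h
    _ ≤ (x + 1) * Real.Gamma x * (x + 1) ^ θ := by
        have : (0 : ℝ) ≤ (x + 1) ^ θ := Real.rpow_nonneg (by linarith) _
        nlinarith
    _ = Real.Gamma x * (x + 1) ^ (1 + θ) := by
        rw [Real.rpow_add (by linarith : (0:ℝ) < x + 1), Real.rpow_one]; ring

end Summit.QuantumFields.YangMills.Theorems.VirialFluxGap.ChebyshevGamma

end
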